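import Summits.QuantumFields.BalabanUV.Beta.GAN24.CombesThomas
import Summits.QuantumFields.BalabanUV.Beta.GAN24.CombesThomasFibre

/-!
# `BalabanUV.Beta.GAN24.CombesThomasFibreStep` — binder row G-an2-4 / (CONV-C), propagator slot, road P1: the DECIMATED, UNIT-NORMALISED
# step resolvent `D_j · KInvStep Lc j · D_j` is the real part of the lattice kernel, AT OFFSET ZERO, of an explicit finite phase-dressed sum
# `kFib` of inverse-fibre entries; hence `SupRateK` (census input (I2) of `GAN24/CombesThomas`) FOLLOWS from an entrywise real-zone
# bound `‖kFib_{j+1} − kFib_j‖ ≤ c θ^j` on explicit finite matrices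

NOT IN PRINT; OUR PROOF ATTEMPT.  HONEST FRAMING (cell contract, verbatim): «discharging `BetaPertH` makes Bałaban's UV stability
UNCONDITIONAL — a real constructive-QFT result; it is NOT the continuum limit and NOT the Clay problem.»  HONEST DEPENDENCY (verbatim):
«continuum YM on T⁴ ⇐ BetaPertH ∧ nine spine estimates (0/9 proved); BetaPertH ⇐ (D1) ∧ (D4) ∧ CAP+tail; G-an2-4 gates asym, D1 and
NE2/3/4.»  [folklore] bookkeeping over the cell's typed objects (an2's `OneStepKernelFamily.dec`/`KInvStep`, asym1's `HessKerDressedUnits.unitK`,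
this row's `GAN24/CombesThomas` + `GAN24/CombesThomasFibre`, pv17/pv23's `latticeKernel` calculus): finite sums, the phase-shift rule of the
lattice kernel, `Re Σ = Σ Re`.  Cites nothing, mints no fact, instantiates NO wall binder, proves NO estimate.  NOT summit progress.

## Contents
§1 `legOff` (block offset of a leg-point pair), `kFibW N M s_f s_m a x′ b y′ : ℂ^{d+1} → ℂ` (the phase-dressed, leg-averaged, unit-scaled sum of
   inverse-fibre entries over the product of the two leg index sets), integrability of its integrand on the real zone, and
   **`unitK_dec_KInv_eq`**: `unitK s_f s_m (dec M (KInv N)) x′ y′ a b = if LegOn N a (M•x′) ∧ LegOn N b (M•y′) then Re (latticeKernel (kFibW …) 0) else 0`.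
§2 the step family: `kFib Lc s_f s_m j := kFibW (Lc^(j+1)) (Lc^j) (s_f j) (s_m j)`, the `j`-FREE support condition (`legOn_step_iff`:
   `LegOn (Lc^(j+1)) a (Lc^j • x′) ↔ LegOn Lc a x′`), **`unitK_KInvStep_eq`**, and **`supRateK_of_kFib`**:
   `(∀ j x′ y′ a b, ∀ p ∈ zone, ‖kFib (j+1) … (ofRealVec p) − kFib j … (ofRealVec p)‖ ≤ c θ^j) → SupRateK d Lc s_f s_m c θ`.
§3 (v1.1, APPEND-ONLY; every v1 declaration byte-identical): `kFibΔ` (phases re-based at the coarse offset), `unitK_KInvStep_eq_offset`, and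
   **`unitDecayK_of_stripRegular`**: a `j`-UNIFORM `StripRegular (kFibΔ … j …) κ Cst` gives `UnitDecayK d Lc s_f s_m (Cst·e^{2κ}) (κ/((d+1)Lc))` (census input (I3)).
So, with `GAN24/CombesThomas.decayCauchy_of_uniformDecays_supRate`, the wall's rate binder `hKall` follows from the uniform decay `hK` and an
ENTRYWISE REAL-ZONE estimate on the explicit finite matrices `kFib j (·)` — the object the fibre algebra of road P3 (pivot / effective form /
Woodbury deviations) and King-Lemma-4.3-type symbol estimates address.  WHAT IS NOT HERE: that estimate ((I2)), the uniform decay ((I3)),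
any `j`-uniformity; the `p ↦ kFib j p` are not simplified (no composition law is used).  NOT BetaPertH, NOT continuum, NOT Clay.
-/

noncomputable section

open Complex MeasureTheory Finset
open scoped BigOperators
open Literature.MathematicalPhysics.QuantumFieldTheory
open Literature.MathematicalPhysics.QuantumFieldTheory.Balaban1983to89
open Literature.MathematicalPhysics.QuantumFieldTheory.Balaban1983to89.Beta
open Literature.Probability.LatticeModels (Torus.proj)
open LatticeForm (quo)
open B4Strip (ofRealVec)
open B4ContourShift (latticeKernel BZ integrand phase)
open B4Green244 (latticeKernel_phase_mul latticeKernel_sum_mul phaseC)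
open B4Green242Bridge (latticeKernel_sub)
open BlochFibreMatrix (Idx stencil pieceMatrix det_trigPolySymbol_ne_zero)
open FibreInverseDecay (cphase trigPolySymbol integrableOn_cphase_mul_inv)
open ExpKernelCalculus (MKer)
open OneStepResolventKernel (Fib KInv)
open OneStepKernelFamily (dec legSet legPt legW KInvStep proj_pow_smul_eq_zero_iff)
open Summit.QuantumFields.BalabanUV.Beta.HessKerDressedUnits (unitK unitK_apply legScale)
open Summit.QuantumFields.BalabanUV.Beta.GAN24.CombesThomas (SupBound SupRate SupRateK)
open Summit.QuantumFields.BalabanUV.Beta.GAN24.CombesThomasFibre (fibInv legIdx LegOn KInv_eq_re_latticeKernel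
  abs_re_latticeKernel_le_of_norm_le)

namespace Summit.QuantumFields.BalabanUV.Beta.GAN24.CombesThomasFibreStep

variable {d : ℕ}

/-! ## §1 The phase-dressed leg sum `kFibW` and the representation of `unitK s_f s_m (dec M (KInv N))` at offset zero -/

section Dec

variable {N : ℕ} [NeZero N]

/-- [folklore] The BLOCK OFFSET of a pair of leg points: `quo N (legPt M a x′ i) − quo N (legPt M b y′ i′)`. -/
def legOff (N M : ℕ) (a : Fib d) (x' : Fin (d + 1) → ℤ) (i : (Fin (d + 1) → ℕ) × ℕ) (b : Fib d) (y' : Fin (d + 1) → ℤ)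
    (i' : (Fin (d + 1) → ℕ) × ℕ) : Fin (d + 1) → ℤ :=
  quo N (legPt M a x' i) - quo N (legPt M b y' i')

/-- [folklore] **THE PHASE-DRESSED, LEG-AVERAGED, UNIT-SCALED FIBRE FUNCTION** of the decimated rescaled resolvent entry
`((x′, a), (y′, b))`: `kFibW N M s_f s_m a x′ b y′ p = Σ_{(i,i′) ∈ legSet a × legSet b} (D_a D_b w_a w_b) · e^{ip·legOff} · (F_N(p)⁻¹)_{legIdx a P_i, legIdx b P′_{i′}}`
(`P_i = legPt M a x′ i`; `D = legScale s_f s_m`, `w = legW`).  An explicit finite sum of inverse-fibre entries — no estimate. -/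
def kFibW (N : ℕ) [NeZero N] (M : ℕ) (sf sm : ℝ) (a : Fib d) (x' : Fin (d + 1) → ℤ) (b : Fib d) (y' : Fin (d + 1) → ℤ) :
    (Fin (d + 1) → ℂ) → ℂ :=
  fun p => ∑ ii ∈ legSet d M a ×ˢ legSet d M b,
    ((legScale (d := d) sf sm a * legScale (d := d) sf sm b * (legW d M a * legW d M b) : ℝ) : ℂ) *
      (cphase (legOff N M a x' ii.1 b y' ii.2) p *
        fibInv N (legIdx N a (legPt M a x' ii.1)) (legIdx N b (legPt M b y' ii.2)) p)

/-- [folklore] The support condition of a leg does not see the leg index: `LegOn N a (legPt M a x′ i) ↔ LegOn N a (M • x′)`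
(field legs: both `True`; multiplier legs: `legPt` IS `M • x′`). -/
theorem legOn_legPt (M : ℕ) (a : Fib d) (x' : Fin (d + 1) → ℤ) (i : (Fin (d + 1) → ℕ) × ℕ) :
    LegOn N a (legPt M a x' i) ↔ LegOn N a ((M : ℤ) • x') := by
  cases a with
  | inl κ => exact Iff.rfl
  | inr κ => exact Iff.rfl

/-- [folklore] Each phase-dressed inverse-fibre entry has an integrable lattice-kernel integrand on the real zone (lit2's
`integrableOn_cphase_mul_inv` + an2's `det_trigPolySymbol_ne_zero`). -/
theorem integrableOn_term (q : Fin (d + 1) → ℤ) (i j : Idx (d + 1) N) (x : Fin (d + 1) → ℤ) :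
    IntegrableOn (integrand (fun p => cphase q p * fibInv N i j p) x) (BZ (d + 1)) :=
  integrableOn_cphase_mul_inv (stencil (d + 1)) (pieceMatrix (N := N)) (fun s _ => det_trigPolySymbol_ne_zero s) q i j x

/-- [folklore] The integrand of a finite weighted sum of multipliers is the weighted sum of the integrands. -/
theorem integrand_sum {ι : Type*} (s : Finset ι) (c : ι → ℂ) (G : ι → (Fin (d + 1) → ℂ) → ℂ) (x : Fin (d + 1) → ℤ) :
    integrand (fun P => ∑ i ∈ s, c i * G i P) x = fun p => ∑ i ∈ s, c i * integrand (G i) x p := by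
  funext p
  unfold integrand
  rw [Finset.sum_mul]
  exact Finset.sum_congr rfl fun i _ => by ring

/-- [folklore] `kFibW` has an integrable lattice-kernel integrand on the real zone, at every offset. -/
theorem integrableOn_kFibW (M : ℕ) (sf sm : ℝ) (a : Fib d) (x' : Fin (d + 1) → ℤ) (b : Fib d) (y' : Fin (d + 1) → ℤ)
    (x : Fin (d + 1) → ℤ) : IntegrableOn (integrand (kFibW N M sf sm a x' b y') x) (BZ (d + 1)) := by
  unfold kFibW
  rw [integrand_sum]
  exact MeasureTheory.integrable_finsetSum _ fun ii _ => (integrableOn_term _ _ _ x).const_mul _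

/-- [folklore] The phase-shift rule at offset zero: `latticeKernel (e^{ip·q} · G) 0 = latticeKernel G q`. -/
theorem latticeKernel_cphase_mul_zero (q : Fin (d + 1) → ℤ) (G : (Fin (d + 1) → ℂ) → ℂ) :
    latticeKernel (fun P => cphase q P * G P) 0 = latticeKernel G q := by
  have h : (fun P => cphase q P * G P) = fun P => cexp (I * phaseC P q) * G P := rfl
  rw [h, latticeKernel_phase_mul, zero_add]

/-- [folklore] **THE DECIMATED RESCALED RESOLVENT AT THE FIBRE LEVEL**: for every blocking `N`, decimation factor `M`, units `(s_f, s_m)`,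
`unitK s_f s_m (dec M (KInv N)) x′ y′ a b = if LegOn N a (M•x′) ∧ LegOn N b (M•y′) then Re (latticeKernel (kFibW N M s_f s_m a x′ b y′) 0) else 0`
(unfold `unitK`, `dec`; an2's `KInv` entry by entry via `KInv_eq_re_latticeKernel`; phase-shift every term to offset `0`; `Re Σ = Σ Re`;
superposition `latticeKernel_sum_mul`). -/
theorem unitK_dec_KInv_eq (M : ℕ) (sf sm : ℝ) (x' y' : Fin (d + 1) → ℤ) (a b : Fib d) :
    unitK sf sm (dec M (KInv (N := N))) x' y' a b =
      if LegOn N a ((M : ℤ) • x') ∧ LegOn N b ((M : ℤ) • y') then (latticeKernel (kFibW N M sf sm a x' b y') 0).re else 0 := by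
  rw [unitK_apply]
  unfold dec
  by_cases h : LegOn N a ((M : ℤ) • x') ∧ LegOn N b ((M : ℤ) • y')
  · rw [if_pos h]
    -- every term of the double sum, rewritten through the inverse fibre matrix and phase-shifted to offset 0
    have hterm : ∀ i ∈ legSet d M a, ∀ i' ∈ legSet d M b,
        legW d M a * legW d M b * KInv (N := N) (legPt M a x' i) (legPt M b y' i') a b =
          legW d M a * legW d M b *
            (latticeKernel (fun P => cphase (legOff N M a x' i b y' i') P *
              fibInv N (legIdx N a (legPt M a x' i)) (legIdx N b (legPt M b y' i')) P) 0).re := by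
      intro i _ i' _
      rw [KInv_eq_re_latticeKernel, if_pos ⟨(legOn_legPt M a x' i).2 h.1, (legOn_legPt M b y' i').2 h.2⟩,
        latticeKernel_cphase_mul_zero]
      rfl
    rw [Finset.sum_congr rfl fun i hi => Finset.sum_congr rfl fun i' hi' => hterm i hi i' hi']
    -- the right-hand side: superposition and `Re`
    unfold kFibW
    rw [latticeKernel_sum_mul _ _ _ _ fun ii _ => integrableOn_term _ _ _ 0, Complex.re_sum, Finset.sum_product]
    rw [Finset.mul_sum, Finset.sum_mul]
    refine Finset.sum_congr rfl fun i _ => ?_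
    rw [Finset.mul_sum, Finset.sum_mul]
    refine Finset.sum_congr rfl fun i' _ => ?_
    rw [Complex.re_ofReal_mul]
    ring
  · rw [if_neg h]
    have hzero : ∀ i ∈ legSet d M a, ∀ i' ∈ legSet d M b,
        legW d M a * legW d M b * KInv (N := N) (legPt M a x' i) (legPt M b y' i') a b = 0 := by
      intro i _ i' _
      rw [KInv_eq_re_latticeKernel, if_neg (fun h' => h ⟨(legOn_legPt M a x' i).1 h'.1, (legOn_legPt M b y' i').1 h'.2⟩), mul_zero]
    rw [Finset.sum_congr rfl fun i hi => Finset.sum_congr rfl fun i' hi' => hzero i hi i' hi']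
    simp

end Dec

/-! ## §2 The step family: `kFib`, the `j`-free support condition, and `SupRateK` from an entrywise real-zone rate -/

section Step

variable {Lc : ℕ} [NeZero Lc]

/-- [folklore] **THE FIBRE FUNCTION OF THE UNIT-NORMALISED STEP RESOLVENT**: `kFib Lc s_f s_m j := kFibW (Lc^(j+1)) (Lc^j) (s_f j) (s_m j)` —
so that `unitK (s_f j) (s_m j) (KInvStep Lc j) x′ y′ a b = Re latticeKernel (kFib … j a x′ b y′) 0` on the support.  Explicit; no estimate. -/
def kFib (Lc : ℕ) [NeZero Lc] (sf sm : ℕ → ℝ) (j : ℕ) (a : Fib d) (x' : Fin (d + 1) → ℤ) (b : Fib d) (y' : Fin (d + 1) → ℤ) :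
    (Fin (d + 1) → ℂ) → ℂ :=
  kFibW (Lc ^ (j + 1)) (Lc ^ j) (sf j) (sm j) a x' b y'

/-- [folklore] THE SUPPORT CONDITION IS `j`-FREE: a multiplier leg of the step-`j` lattice sits on the `Lc`-coarse points of that lattice,
whatever `j` (an2's `proj_pow_smul_eq_zero_iff`); field legs are everywhere. -/
theorem legOn_step_iff (j : ℕ) (a : Fib d) (x' : Fin (d + 1) → ℤ) :
    LegOn (Lc ^ (j + 1)) a (((Lc ^ j : ℕ) : ℤ) • x') ↔ LegOn Lc a x' := by
  cases a with
  | inl κ => exact Iff.rfl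
  | inr κ => exact proj_pow_smul_eq_zero_iff j x'

/-- [folklore] **THE UNIT-NORMALISED STEP RESOLVENT AT THE FIBRE LEVEL**:
`unitK (s_f j) (s_m j) (KInvStep Lc j) x′ y′ a b = if LegOn Lc a x′ ∧ LegOn Lc b y′ then Re (latticeKernel (kFib Lc s_f s_m j a x′ b y′) 0) else 0`. -/
theorem unitK_KInvStep_eq (sf sm : ℕ → ℝ) (j : ℕ) (x' y' : Fin (d + 1) → ℤ) (a b : Fib d) :
    unitK (sf j) (sm j) (KInvStep (d := d) Lc j) x' y' a b =
      if LegOn Lc a x' ∧ LegOn Lc b y' then (latticeKernel (kFib Lc sf sm j a x' b y') 0).re else 0 := by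
  unfold KInvStep kFib
  rw [unitK_dec_KInv_eq]
  simp only [legOn_step_iff]

/-- [folklore] `kFib` has an integrable lattice-kernel integrand on the real zone, at every offset. -/
theorem integrableOn_kFib (sf sm : ℕ → ℝ) (j : ℕ) (a : Fib d) (x' : Fin (d + 1) → ℤ) (b : Fib d) (y' : Fin (d + 1) → ℤ)
    (x : Fin (d + 1) → ℤ) : IntegrableOn (integrand (kFib Lc sf sm j a x' b y') x) (BZ (d + 1)) :=
  integrableOn_kFibW _ _ _ _ _ _ _ x

/-- [folklore] The real-zone norm of a multiplier with integrable offset-zero integrand is integrable (`|e^{ip·0}| = 1`). -/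
theorem integrableOn_norm_of_integrand_zero {G : (Fin (d + 1) → ℂ) → ℂ} (h : IntegrableOn (integrand G 0) (BZ (d + 1))) :
    IntegrableOn (fun p => ‖G (ofRealVec p)‖) (BZ (d + 1)) := by
  have e : (fun p => ‖G (ofRealVec p)‖) = fun p => ‖integrand G 0 p‖ := by
    funext p
    unfold integrand
    rw [norm_mul, B4ContourShift.norm_cexp_phase, mul_one]
  rw [e]
  exact h.norm

/-- [folklore] **(I2) AT THE FIBRE LEVEL ⇒ `SupRateK`**: an ENTRYWISE REAL-ZONE rate `‖kFib (j+1) … p − kFib j … p‖ ≤ c θ^j` for the explicit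
finite phase-dressed sums of inverse-fibre entries gives the one-step sup-norm rate of the unit-normalised step resolvents
(`GAN24/CombesThomas.SupRateK d Lc s_f s_m c θ`), with the SAME `c, θ`.  Combined with `GAN24/CombesThomas.decayCauchy_of_uniformDecays_supRate`
this is the wall's `hKall` from `hK` + a finite-matrix estimate.  Nothing is estimated here. -/
theorem supRateK_of_kFib (sf sm : ℕ → ℝ) {c θ : ℝ} (hc : 0 ≤ c) (hθ : 0 ≤ θ)
    (hrate : ∀ j (x' y' : Fin (d + 1) → ℤ) (a b : Fib d), ∀ p ∈ BZ (d + 1),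
      ‖kFib Lc sf sm (j + 1) a x' b y' (ofRealVec p) - kFib Lc sf sm j a x' b y' (ofRealVec p)‖ ≤ c * θ ^ j) :
    SupRateK d Lc sf sm c θ := by
  intro j x' y' a b
  rw [HessKerDressedLimit.mker_sub_apply]
  dsimp only
  rw [unitK_KInvStep_eq, unitK_KInvStep_eq]
  by_cases h : LegOn Lc a x' ∧ LegOn Lc b y'
  · rw [if_pos h, if_pos h, ← Complex.sub_re,
      ← latticeKernel_sub 0 (integrableOn_kFib sf sm (j + 1) a x' b y' 0) (integrableOn_kFib sf sm j a x' b y' 0)]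
    refine abs_re_latticeKernel_le_of_norm_le _ 0 ?_ (hrate j x' y' a b)
    refine integrableOn_norm_of_integrand_zero (G := fun P => kFib Lc sf sm (j + 1) a x' b y' P - kFib Lc sf sm j a x' b y' P) ?_
    have e : integrand (fun P => kFib Lc sf sm (j + 1) a x' b y' P - kFib Lc sf sm j a x' b y' P) 0 =
        fun p => integrand (kFib Lc sf sm (j + 1) a x' b y') 0 p - integrand (kFib Lc sf sm j a x' b y') 0 p := by
      funext p; unfold integrand; ring
    rw [e]
    exact (integrableOn_kFib sf sm (j + 1) a x' b y' 0).sub (integrableOn_kFib sf sm j a x' b y' 0)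
  · rw [if_neg h, if_neg h, sub_zero, abs_zero]
    exact mul_nonneg hc (pow_nonneg hθ j)

end Step

/-! ## §3 (v1.1, APPEND-ONLY) The representation at the COARSE OFFSET and `UnitDecayK` from `j`-uniform strip regularity (census input (I3)) -/

section StripDecay

variable {Lc : ℕ} [NeZero Lc]

open B4ContourShift (StripRegular supNorm latticeKernel_decay ofRealVec_mem_Strip)
open Summit.QuantumFields.BalabanUV.Beta.GAN24.CombesThomas (UnitDecayK)
open B12Sec2to5 (l1)

/-- [folklore] Additivity of the Bloch character: `cphase (u + v) p = cphase u p · cphase v p`. -/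
theorem cphase_add_eq_mul (u v : Fin (d + 1) → ℤ) (p : Fin (d + 1) → ℂ) : cphase (u + v) p = cphase u p * cphase v p := by
  unfold cphase
  rw [← Complex.exp_add, ← mul_add, ← Finset.sum_add_distrib]
  congr 2
  exact Finset.sum_congr rfl fun μ _ => by simp only [Pi.add_apply, Int.cast_add]; ring

/-- [folklore] `cphase 0 p = 1`. -/
theorem cphase_zero_left (p : Fin (d + 1) → ℂ) : cphase (0 : Fin (d + 1) → ℤ) p = 1 := by
  unfold cphase
  simp

/-- [folklore] **THE FIBRE FUNCTION AT THE COARSE OFFSET**: `kFibΔ := cphase (quo Lc y′ − quo Lc x′) · kFib` — the same explicit finite sum with its phases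
re-based, so that the unit-normalised step resolvent entry `((x′,a),(y′,b))` is `Re latticeKernel kFibΔ (quo Lc x′ − quo Lc y′)` and the decay in the
coarse offset can be read off a strip bound (`B4ContourShift.latticeKernel_decay`).  Explicit; no estimate. -/
def kFibΔ (Lc : ℕ) [NeZero Lc] (sf sm : ℕ → ℝ) (j : ℕ) (a : Fib d) (x' : Fin (d + 1) → ℤ) (b : Fib d) (y' : Fin (d + 1) → ℤ) :
    (Fin (d + 1) → ℂ) → ℂ :=
  fun p => cphase (quo Lc y' - quo Lc x') p * kFib Lc sf sm j a x' b y' p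

/-- [folklore] Re-basing the phase: `latticeKernel kFib 0 = latticeKernel kFibΔ (quo Lc x′ − quo Lc y′)`. -/
theorem latticeKernel_kFib_zero_eq (sf sm : ℕ → ℝ) (j : ℕ) (a : Fib d) (x' : Fin (d + 1) → ℤ) (b : Fib d) (y' : Fin (d + 1) → ℤ) :
    latticeKernel (kFib Lc sf sm j a x' b y') 0 = latticeKernel (kFibΔ Lc sf sm j a x' b y') (quo Lc x' - quo Lc y') := by
  have h : kFib Lc sf sm j a x' b y' = fun P => cphase (quo Lc x' - quo Lc y') P * kFibΔ Lc sf sm j a x' b y' P := by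
    funext P
    unfold kFibΔ
    rw [← mul_assoc, ← cphase_add_eq_mul, sub_add_sub_cancel, sub_self, cphase_zero_left, one_mul]
  rw [h, latticeKernel_cphase_mul_zero]

/-- [folklore] **THE UNIT-NORMALISED STEP RESOLVENT AT THE COARSE OFFSET**:
`unitK (s_f j) (s_m j) (KInvStep Lc j) x′ y′ a b = if LegOn Lc a x′ ∧ LegOn Lc b y′ then Re (latticeKernel (kFibΔ … j a x′ b y′) (quo Lc x′ − quo Lc y′)) else 0`. -/
theorem unitK_KInvStep_eq_offset (sf sm : ℕ → ℝ) (j : ℕ) (x' y' : Fin (d + 1) → ℤ) (a b : Fib d) :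
    unitK (sf j) (sm j) (KInvStep (d := d) Lc j) x' y' a b =
      if LegOn Lc a x' ∧ LegOn Lc b y' then (latticeKernel (kFibΔ Lc sf sm j a x' b y') (quo Lc x' - quo Lc y')).re else 0 := by
  rw [unitK_KInvStep_eq, latticeKernel_kFib_zero_eq]

/-- [folklore] Unit-lattice `ℓ¹` distance against the coarse offset: `|x′ − y′|₁ ≤ Lc · |quo x′ − quo y′|₁ + 2 Lc (d+1)`. -/
theorem l1_sub_le_coarse (x' y' : Fin (d + 1) → ℤ) :
    l1 (x' - y') ≤ (Lc : ℝ) * l1 (quo Lc x' - quo Lc y') + 2 * ((Lc : ℝ) * (d + 1)) := by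
  have hx := BlochFibreMatrix.eq_repZ_add_zsmul_quo (N := Lc) x'
  have hy := BlochFibreMatrix.eq_repZ_add_zsmul_quo (N := Lc) y'
  have hsplit : x' - y' = (Lc : ℤ) • (quo Lc x' - quo Lc y') +
      (LatticeForm.repZ (Torus.proj Lc x') - LatticeForm.repZ (Torus.proj Lc y')) := by
    conv_lhs => rw [hx, hy]
    rw [smul_sub]; abel
  rw [hsplit]
  have h3 := KKTFluctuationKernel.l1_repZ_le (N := Lc) (Torus.proj Lc x')
  have h4 := KKTFluctuationKernel.l1_repZ_le (N := Lc) (Torus.proj Lc y')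
  calc l1 ((Lc : ℤ) • (quo Lc x' - quo Lc y') + (LatticeForm.repZ (Torus.proj Lc x') - LatticeForm.repZ (Torus.proj Lc y')))
      ≤ l1 ((Lc : ℤ) • (quo Lc x' - quo Lc y')) + l1 (LatticeForm.repZ (Torus.proj Lc x') - LatticeForm.repZ (Torus.proj Lc y')) :=
        StepJetData.l1_add_le _ _
    _ ≤ (Lc : ℝ) * l1 (quo Lc x' - quo Lc y') +
          (l1 (LatticeForm.repZ (N := Lc) (Torus.proj Lc x')) + l1 (LatticeForm.repZ (N := Lc) (Torus.proj Lc y'))) := by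
        rw [ExpKernelCalculus.l1_natSmul]
        exact add_le_add le_rfl (KKTFluctuationKernel.l1_sub_le _ _)
    _ ≤ (Lc : ℝ) * l1 (quo Lc x' - quo Lc y') + 2 * ((Lc : ℝ) * (d + 1)) := by linarith

/-- [folklore] **(I3) AT THE FIBRE LEVEL ⇒ `UnitDecayK`**: a `j`-UNIFORM strip bound — `StripRegular (kFibΔ … j a x′ b y′) κ Cst` for all `j, x′, y′, a, b` with
ONE `κ ≥ 0`, ONE `Cst` — gives the wall's uniform decay binder `UnitDecayK d Lc s_f s_m (Cst·e^{2κ}) (κ/((d+1)·Lc))` (Paley–Wiener: pv17's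
`latticeKernel_decay`, sup-norm → `ℓ¹` rate `κ/(d+1)` on the coarse offset → `κ/((d+1)Lc)` on the unit lattice).  Nothing is estimated here. -/
theorem unitDecayK_of_stripRegular (sf sm : ℕ → ℝ) {κ Cst : ℝ} (hκ : 0 ≤ κ)
    (h : ∀ j (x' y' : Fin (d + 1) → ℤ) (a b : Fib d), StripRegular (kFibΔ Lc sf sm j a x' b y') κ Cst) :
    UnitDecayK d Lc sf sm (Cst * Real.exp (2 * κ)) (κ / ((d + 1) * Lc)) := by
  intro j x' y' a b
  have hCst : 0 ≤ Cst := (norm_nonneg _).trans ((h 0 0 0 a b).bound _ (ofRealVec_mem_Strip hκ (FibreInverseDecay.BZ_nonempty (d + 1)).some_mem))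
  have hLc : (0 : ℝ) < Lc := by exact_mod_cast Nat.pos_of_ne_zero (NeZero.ne Lc)
  dsimp only
  rw [unitK_KInvStep_eq_offset]
  split_ifs with hc
  · have h1 := latticeKernel_decay (h j x' y' a b) hκ (quo Lc x' - quo Lc y')
    have h2 := h1.trans (mul_le_mul_of_nonneg_left (FibreInverseDecay.exp_supNorm_le_exp_l1 hκ _) hCst)
    -- h2 : ‖LK‖ ≤ Cst * exp (-(κ/(d+1)) * l1 (quo x' − quo y'))
    have h3 := l1_sub_le_coarse (Lc := Lc) x' y'
    refine (Complex.abs_re_le_norm _).trans (h2.trans ?_)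
    rw [mul_assoc]
    refine mul_le_mul_of_nonneg_left ?_ hCst
    rw [← Real.exp_add]
    refine Real.exp_le_exp.2 ?_
    have hd : (0 : ℝ) < (d + 1 : ℝ) := by positivity
    have hkd : 0 ≤ κ / ((d + 1 : ℝ) * Lc) := div_nonneg hκ (by positivity)
    -- goal: -(κ/(d+1)) * l1 Δ ≤ 2κ + -(κ/((d+1)Lc)) * l1 (x' - y')
    have key : κ / ((d + 1) * Lc) * l1 (x' - y') ≤ κ / (d + 1) * l1 (quo Lc x' - quo Lc y') + 2 * κ := by
      calc κ / ((d + 1) * Lc) * l1 (x' - y')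
          ≤ κ / ((d + 1) * Lc) * ((Lc : ℝ) * l1 (quo Lc x' - quo Lc y') + 2 * ((Lc : ℝ) * (d + 1))) :=
            mul_le_mul_of_nonneg_left h3 hkd
        _ = κ / (d + 1) * l1 (quo Lc x' - quo Lc y') + 2 * κ := by field_simp
    show -(κ / (↑d + 1)) * l1 (quo Lc x' - quo Lc y') ≤ 2 * κ + -(κ / ((↑d + 1) * ↑Lc)) * l1 (x' - y')
    linarith
  · rw [abs_zero]; positivity

end StripDecay

end Summit.QuantumFields.BalabanUV.Beta.GAN24.CombesThomasFibreStep

end
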